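import Summits.HodgeConjecture.HodgeConjecture.Theorems.Ring2AbelianAllAndreCanonicalInverse
import Summits.HodgeConjecture.HodgeConjecture.Theorems.Ring2AbelianAllAndreFibreTraceRestriction
import Literature.AlgebraicGeometry.HodgeTheory.HodgeClassOfMorphismProofs
import Summits.HodgeConjecture.HodgeConjecture.Theorems.Ring2AbelianAllAndreTransportLatticeCM
import Summits.HodgeConjecture.HodgeConjecture.Theorems.BoundaryReadoutPullbackAlgebraic
import HarnessLib

/-!
# Ring 2 · sub-cell AbelianAll (ALL ABELIAN VARIETIES), André axis, part XLVI-c — THE HALF INVERSE IS A CYCLE ON THE PRODUCT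
# FAMILY `𝒳 × X_t → S`: its trace on the member `X_s` is the RESTRICTED CLASS on `X_s × X_t`, β is the lift problem for a pencil
# over the SAME CURVE `S` (not over `S × S`), and a half inverse transports the invariants to EVERY member algebraically

HONEST FRAMING (page 1, verbatim): **research route, not a corollary; conditional on HC_CM plus one named
minimal statement.** Cell line: research route conditional on HC_CM; not a corollary; Q11.4-sentence-2
already refuted in dim ≥ 3. Nothing in this file proves a case of the Hodge conjecture or of `B(X)` for a named `X`; `HC_CM`
(`Theses.RankFourFaces.CMAbelianHodge`) does NOT occur; item `Theses.RankFourFaces.CMToAbelian` (stmt-16267) stays OPEN; N104 untouched;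
no node is born (0 `def`, 0 `sorry`, no named fact). Seat `pub-hodge-ring2-ab-andre-2`, gen 38.

## Content (theorems only; standard axioms; fact-free — the pull-back of algebraic classes is the tree's PROVED
`fulton1998_map_mem_algebraicClasses_holds`)

Part XLVI-b: β at `t` ⟺ HALF INVERSES — algebraic correspondences `M : Hᵏ(X_t) → Hᵏ(𝒳)` FROM ONE FIBRE with fibre trace `j_t^* M` = the
invariant projector `P_t` (`j_t^* M j_t^* = j_t^*`, `j_t^* M (ker j_{t*}) = 0`). Such an `M` is `[μ]_*` for a codimension-`d` class `μ` on the
`(2d+1)`-fold `𝒳 × X_t` — the total space of the family `𝒳 × X_t → 𝒳 → S` whose member over `s` is the abelian `2d`-fold `X_s × X_t` (via the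
braiding and a chart `A ≅ X_t` it is the tree's compact abelian pencil `snd A.X 𝒳 ≫ f` of part XXXII-a). THIS FILE (independent of parts
XLVI-a/b: it imports neither) computes the trace of `[μ]_*` on every member as a RESTRICTED CYCLE CLASS, exactly as part XLIV-b did for
self-correspondences of `𝒳`, and records the topological side:

* §0 **`exists_corrAction_eq_smul`** (general smooth projective `Y`, `X`): EVERY linear map `Hᵃ(X) → Hᵇ(Y)` is `t⁻¹ • [γ]_*` for a class `γ` on
  `Y × X` — the surjectivity half of Künneth for correspondences (`γ = Σ pr_Y^* φ(x_i) ∪ pr_X^* x_i^∨`, Voisin I (11.11); the tree's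
  `corrAction_sum_cross_apply` + `exists_rational_dual`).
* §1 **`exists_map_fiberι_corrAction_eq_smul_restrict`** — ONE clean base change (Fulton Thm. 6.2 (a) on the tree's carriers, the square
  `X_s × X_t → 𝒳 × X_t` over `j_s`): there is `K ≠ 0` (depending on the pencil, `s` and the orientation only) with, for every class `μ` of
  `𝒳 × X_t`, every degree and every `x ∈ H^•(X_t)`, **`j_s^* ([μ]_* x) = K • [(j_s × 1)^* μ]_* x`**; `map_whiskerRight_fiberι_mem_algebraicClasses`:
  the restriction of an algebraic class is algebraic (Fulton Cor. 19.2 (b), PROVED in the tree).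
* §2 **`halfInverse_iff_exists_restrict_acts_as_invariantProjector`** — a half inverse at `t` in degree `k` EXISTS iff some algebraic class
  `μ ∈ N^d(𝒳 × X_t)` RESTRICTS on the member `X_t × X_t` over `t` to a class acting on `Hᵏ(X_t)` as `P_t`: **the half inverse is the LIFT
  PROBLEM (L) for the product family over the curve `S` at the class `P_t` of its member over `t`** — compare part XLIV-b/c (β = the lift of
  the same `P_t` from the fibre over `(t,t)` of the square family over the SURFACE `S × S`). **`exists_topological_halfInverse`** (+ `_class`):
  a TOPOLOGICAL half inverse always exists (a linear section of `j_t^*` after the invariant projector) and is the correspondence of a class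
  `W₀` of `𝒳 × X_t` — β asks for an ALGEBRAIC one. (The β-facing corollaries — middle degree, all degrees — are in part XLVI-d §1.)
* §3 **`map_fiberι_halfInverse_eq`** — a half inverse at `t` is a transport to EVERY member: `j_s^* M j_t^* = j_s^*` and `j_s^* M (ker j_{t*}) = 0`
  for ALL `s` (`ker j_s^* = ker j_t^*`, part XVII; valid for any linear `M`); hence **`exists_algebraic_transport_of_halfInverse`**: for every
  member `X_s` the class `K • (j_s × 1)^* μ ∈ N^d(X_s × X_t)` is an ALGEBRAIC class on the abelian `2d`-fold `X_s × X_t` whose correspondence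
  carries `j_t^* W ↦ j_s^* W` and kills `ker j_{t*}` — part XLV-c's off-diagonal conclusion, from the half inverse (one level down) and for
  the members of ONE pencil over `S`; `transport_unique'`: that correspondence is unique.

## Honest status

Fact-free reformulations, EQUIVALENT to β (XLVI-b). What is gained is the habitat of the open instance: for the W₆ pencils, `B⋆` of the
7-fold `𝒳` ⟺ ONE codimension-6 algebraic cycle on the 13-fold `𝒳 × X_t` — total space of a pencil of abelian 12-folds `X_s × X_t` over the
base curve `S` — restricting on the member `X_t × X_t` to the projector onto `ℂθ³ ⊕ W_t` (an algebraic class there, part XLI-b); its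
restrictions to the other members are then the (necessarily algebraic) transports `ℂθ_t³ ⊕ W_t → ℂθ_s³ ⊕ W_s`, i.e. classes of the strength of
the Hodge conjecture for products `X_s × X_t` of two Weil sixfolds (part XLV-c/d) — strength UNCHANGED (Tankeev 2008). PRINT: restriction of a
correspondence to a member = Fulton's refined Gysin pull-back [Fulton1998, Thm. 6.2 (a), Cor. 19.2]; the one-parameter habitat `𝒳 × X_t` for
`B` of abelian-fibred total spaces was not located ([Tankeev2003, §10] uses `𝒳 ×_C 𝒳`; [Abdulali1994FamiliesAV, §5] the fibre square).
Nothing minimal is claimed; N104 untouched. EDGE LABELS: all K (no binder).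
References: Fulton1998 (Prop. 1.7, Thm. 6.2 (a), §16.1, Cor. 19.2); FultonYoungTableaux1997 (App. B (5)–(7)); Kleiman1968AlgebraicCycles (§1.3);
VoisinHodgeII2003 ((10.7), Prop. 9.21); DeligneHodgeII1971 (4.1.1); Andre1996Motifs (§5.1, §6.3); Tankeev2003 (Thm. 10.1); Tankeev2008 ((i)–(ii)).
-/

noncomputable section

set_option linter.dupNamespace false

namespace Summit.HodgeConjecture.HodgeConjecture.Ring2.AbelianAll

open CategoryTheory CategoryTheory.Limits AlgebraicGeometry MonoidalCategory CartesianMonoidalCategory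
open Literature.AlgebraicGeometry Literature.AlgebraicGeometry.Motives
open Literature.AlgebraicGeometry.HodgeTheory
open Literature.AlgebraicTopology.SingularHomology (singularCohomology cupProduct cupProduct_map cupPairing)
open Summit.HodgeConjecture.HodgeConjecture.Theorems (deg_fiberGysin_aux fulton1998_map_mem_algebraicClasses_holds)

variable {𝒳 S : SchemeOver ℂ} {d : ℕ} {f : 𝒳 ⟶ S} (hf : IsCompactAbelianPencil f d)

/-- `𝐆[hf, s, k]` — `j_{s*} : Hᵏ(X_s(ℂ); ℂ) → H^{k+2}(𝒳(ℂ); ℂ)` for the complex orientations (display notation, as in part XL-a).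
[cite: FultonYoungTableaux1997, Appendix B §B.1 (5)] -/
local notation3 (prettyPrint := false) "𝐆[" hf ", " s ", " k "]" =>
  complexGysin complexOrientationFamily (IsCompactAbelianPencil.isSmoothProjective_fiberOver hf s)
    (IsCompactAbelianPencil.isSmoothProjective_total hf) (fiberι f s) (deg_fiberGysin_aux k d)

/-- `𝐣[s, k]` — `j_s^* : Hᵏ(𝒳(ℂ); ℂ) → Hᵏ(X_s(ℂ); ℂ)` as a linear map (display notation). [cite: VoisinHodgeI2002, §7.3.2] -/
local notation3 (prettyPrint := false) "𝐣[" s ", " k "]" => (complexBetti.map (fiberι f s) k).hom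

/-- `𝐌[hf, t, hab]` — the action `[μ]_* : Hᵏ(X_t) → Hᵇ(𝒳)` (`k + 2e = b + 2d`) of a class `μ ∈ H^{2e}((𝒳 × X_t)(ℂ))` as a correspondence FROM
the fibre TO the total space, for the complex orientations (display notation for the tree's `corrAction`). [cite: VoisinHodgeII2003, proof of Thm. 10.17 (10.7)] -/
local notation3 (prettyPrint := false) "𝐌[" hf ", " t ", " hab "]" =>
  corrAction complexOrientationFamily (IsCompactAbelianPencil.isSmoothProjective_total hf)
    (IsCompactAbelianPencil.isSmoothProjective_fiberOver hf t) hab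

/-- `𝐑₂[hf, s, t, hab]` — the action `Hᵏ(X_t) → Hᵇ(X_s)` of a class of `X_s × X_t` (a correspondence between two members), for the complex
orientations (display notation). [cite: VoisinHodgeII2003, proof of Thm. 10.17 (10.7)] -/
local notation3 (prettyPrint := false) "𝐑₂[" hf ", " s ", " t ", " hab "]" =>
  corrAction complexOrientationFamily (IsCompactAbelianPencil.isSmoothProjective_fiberOver hf s)
    (IsCompactAbelianPencil.isSmoothProjective_fiberOver hf t) hab

/-! ## §0 Every linear map is a correspondence (Künneth surjectivity, general) -/

section Surjective

/-- **EVERY LINEAR MAP `Hᵃ(X) → Hᵇ(Y)` IS A CORRESPONDENCE, up to a non-zero scalar** (Künneth surjectivity for correspondences; fact-free).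
For smooth projective `Y` (`dim m`), `X` (`dim n`), degrees `a + 2e = b + 2n`, `a + d' = 2n`, and ANY linear `φ : Hᵃ(X(ℂ); ℂ) → Hᵇ(Y(ℂ); ℂ)` there
are a class `γ ∈ H^{2e}((Y × X)(ℂ); ℂ)` and `t ≠ 0` with `[γ]_* = t • φ`: `γ = Σ_i pr_Y^* φ(x_i) ∪ pr_X^* x_i^∨` for a basis `(x_i)` of `Hᵃ(X)` with
dual family `(x_i^∨)` for the (perfect) Poincaré pairing, acting by Voisin's (11.11) `γ_*(u) = ± λ Σ_i ⟨u, x_i^∨⟩ φ(x_i) = ± λ φ(u)`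
(`λ ≠ 0` a fibre integral). [cite: VoisinHodgeI2002, §11.3.3 Thm. 11.38 and Lemma 11.41 (11.11)] [cite: HatcherAT2002, §3.3 Prop. 3.38] -/
theorem exists_corrAction_eq_smul (μ : OrientationFamily) {m n : ℕ} {Y X : SchemeOver ℂ} (hY : IsSmoothProjective m Y)
    (hX : IsSmoothProjective n X) {a b e d' : ℕ} (hab : a + 2 * e = b + 2 * n) (had : a + d' = 2 * n)
    (φ : complexBetti X a →ₗ[ℂ] complexBetti Y b) :
    ∃ (γ : complexBetti (Y ⊗ X) (2 * e)) (t : ℂ), t ≠ 0 ∧ corrAction μ hY hX hab γ = t • φ := by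
  classical
  have hbd : b + d' = 2 * e := by omega
  obtain ⟨k, x, xd, c, hc0, -, -, hdual⟩ := exists_rational_dual μ hX had
  have hd' : ∀ i j, cupPairing (μ hX) had (x i) (c⁻¹ • xd j) = if i = j then 1 else 0 := by
    intro i j
    rw [map_smul, hdual, smul_eq_mul]
    split_ifs
    · exact inv_mul_cancel₀ hc0
    · exact mul_zero _
  obtain ⟨ω₁, lam, hlam0, hω₁, hlam⟩ := exists_complexGysin_fst_map_snd_eq_smul_one μ hY hX
  refine ⟨∑ i, cupProduct hbd (complexBetti.map (fst Y X) b (φ (x i))) (complexBetti.map (snd Y X) d' (c⁻¹ • xd i)),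
    (-1 : ℂ) ^ (a * b) * lam, mul_ne_zero (pow_ne_zero _ (neg_ne_zero.2 one_ne_zero)) hlam0, ?_⟩
  refine LinearMap.ext fun u ↦ ?_
  rw [corrAction_sum_cross_apply μ hY hX hab had hbd φ x (fun i ↦ c⁻¹ • xd i) hω₁ hlam u, LinearMap.smul_apply]
  congr 1
  conv_rhs => rw [PerfPairDuality.eq_sum_smul_self x hd' u]
  rw [map_sum]
  simp_rw [map_smul]

end Surjective

/-! ## §1 The trace on a member of a correspondence `X_t ⊢ 𝒳` is the restricted class on `X_s × X_t` -/

section Restriction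

/-- **ONE CLEAN BASE CHANGE: `j_s^* ∘ [μ]_* = K · [(j_s × 1)^* μ]_*`.** Let `f : 𝒳 ⟶ S` be a compact pencil of abelian `d`-folds and
`s, t ∈ S(ℂ)`. There is ONE scalar `K ≠ 0` such that for every class `μ ∈ H^{2e}((𝒳 × X_t)(ℂ); ℂ)`, every degree (`k + 2e = b + 2d`) and every
`x ∈ Hᵏ(X_t)`: `j_s^* ([μ]_* x) = K • [(j_s ▷ X_t)^* μ]_* x` in `Hᵇ(X_s)` — the trace on the member `X_s` of the correspondence `[μ]_* : H^•(X_t) → H^•(𝒳)`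
is the action of the RESTRICTION of `μ` to the member `X_s × X_t` of the product family `𝒳 × X_t → S`. Clean base change (Fulton Thm. 6.2 (a),
the tree's `complexGysin_cleanBaseChange`) for the transversal square `X_s × X_t → 𝒳 × X_t` over `j_s` (first projections; the incidence map is
a closed immersion by retraction), then `(j_s ▷ X_t)^* (pr_2^* x ∪ μ) = pr_2^* x ∪ (j_s ▷ X_t)^* μ`; `K ≠ 0` by a fibre integral.
[cite: Fulton1998, Prop. 1.7, Thm. 6.2 (a) and §16.1] [cite: FultonYoungTableaux1997, Appendix B §B.1 (5)–(7)] -/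
theorem exists_map_fiberι_corrAction_eq_smul_restrict (s t : ComplexPoints S) :
    ∃ K : ℂ, K ≠ 0 ∧ ∀ ⦃k e b : ℕ⦄ (hab : k + 2 * e = b + 2 * d) (μ : complexBetti (𝒳 ⊗ fiberOver f t) (2 * e))
        (x : complexBetti (fiberOver f t) k),
      𝐣[s, b] (𝐌[hf, t, show k + 2 * e = b + 2 * d by omega] μ x) =
        K • 𝐑₂[hf, s, t, hab] (complexBetti.map (fiberι f s ▷ fiberOver f t) (2 * e) μ) x := by
  have hX := hf.isSmoothProjective_total
  have hXt := hf.isSmoothProjective_fiberOver t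
  have hXs := hf.isSmoothProjective_fiberOver s
  have hXXt := IsSmoothProjective.tensor_holds hX hXt
  have hXsXt := IsSmoothProjective.tensor_holds hXs hXt
  set j : fiberOver f s ⟶ 𝒳 := fiberι f s with hj
  haveI : IsSeparated S.hom := hf.isSmoothProjective_base.isProjectiveOver.isProper.toIsSeparated
  haveI : IsClosedImmersion j.left := Motives.isClosedImmersion_fiberι_left f s
  haveI : IsSeparated ((𝒳 ⊗ fiberOver f t) ⊗ fiberOver f s).hom :=
    (IsSmoothProjective.isProper_holds (IsSmoothProjective.tensor_holds hXXt hXs)).toIsSeparated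
  -- the square `X_s × X_t → 𝒳 × X_t` over `j : X_s → 𝒳` (first projections)
  haveI hA : IsClosedImmersion (lift (j ▷ fiberOver f t) (fst (fiberOver f s) (fiberOver f t))).left := by
    refine isClosedImmersion_left_of_retraction _ (lift (snd (𝒳 ⊗ fiberOver f t) (fiberOver f s)) (fst _ _ ≫ snd 𝒳 (fiberOver f t))) ?_
    ext
    · simp only [Category.assoc, lift_fst, lift_snd, Category.id_comp]
    · simp only [Category.assoc, lift_snd, lift_fst_assoc, whiskerRight_snd, Category.id_comp]
  have hinc : ∀ (P : ComplexPoints (𝒳 ⊗ fiberOver f t)) (Q : ComplexPoints (fiberOver f s)),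
      AlgPoints.map (fst 𝒳 (fiberOver f t)) P = AlgPoints.map j Q →
      ∃ R : ComplexPoints (fiberOver f s ⊗ fiberOver f t), AlgPoints.map (j ▷ fiberOver f t) R = P ∧
        AlgPoints.map (fst (fiberOver f s) (fiberOver f t)) R = Q := by
    intro P Q h
    set R : ComplexPoints (fiberOver f s ⊗ fiberOver f t) :=
      AlgPoints.prodEquiv.symm (Q, AlgPoints.map (snd 𝒳 (fiberOver f t)) P) with hR
    have hR1 : AlgPoints.map (fst (fiberOver f s) (fiberOver f t)) R = Q := by
      rw [← AlgPoints.prodEquiv_apply_fst, hR, Equiv.apply_symm_apply]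
    have hR2 : AlgPoints.map (snd (fiberOver f s) (fiberOver f t)) R = AlgPoints.map (snd 𝒳 (fiberOver f t)) P := by
      rw [← AlgPoints.prodEquiv_apply_snd, hR, Equiv.apply_symm_apply]
    refine ⟨R, AlgPoints.prodEquiv.injective (Prod.ext ?_ ?_), hR1⟩
    · rw [AlgPoints.prodEquiv_apply_fst, AlgPoints.prodEquiv_apply_fst, ← AlgPoints.map_comp_apply, whiskerRight_fst,
        AlgPoints.map_comp_apply, hR1, h]
    · rw [AlgPoints.prodEquiv_apply_snd, AlgPoints.prodEquiv_apply_snd, ← AlgPoints.map_comp_apply, whiskerRight_snd, hR2]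
  obtain ⟨K, hK⟩ := complexGysin_cleanBaseChange complexOrientationFamily hXXt hX hXs hXsXt (fst 𝒳 (fiberOver f t)) j
    (j ▷ fiberOver f t) (fst (fiberOver f s) (fiberOver f t)) (by omega) hinc
  refine ⟨K, ?_, fun k e b hab μ x ↦ ?_⟩
  · -- `K ≠ 0`: test on a fibre integral `pr_{1*} pr_2^* w ≠ 0` in `H⁰(𝒳)`, whose pull-back to `X_s` is non-zero
    obtain ⟨w, hw⟩ := exists_complexGysin_fst_map_snd_ne_zero complexOrientationFamily hX hXt
    obtain ⟨c, hc⟩ := exists_eq_smul_one complexOrientationFamily hX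
      (complexGysin complexOrientationFamily hXXt hX (fst 𝒳 (fiberOver f t)) (show 2 * d + 2 * (d + 1) = 0 + 2 * (d + 1 + d) by omega)
        (complexBetti.map (snd 𝒳 (fiberOver f t)) (2 * d) w))
    have hc0 : c ≠ 0 := by
      rintro rfl
      exact hw (by rw [hc, zero_smul])
    have h1 : singularCohomology.one ℂ (ComplexPoints (fiberOver f s)) ≠ 0 := by
      intro h0
      apply fiberGysin_one_ne_zero hf s
      rw [h0, map_zero]
    intro hK0
    have h := hK (show 2 * d + 2 * (d + 1) = 0 + 2 * (d + 1 + d) by omega) (complexBetti.map (snd 𝒳 (fiberOver f t)) (2 * d) w)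
    rw [hK0, zero_smul, hc, map_smul] at h
    change c • singularCohomology.map ℂ ℂ (AlgPoints.mapContinuous (L := ℂ) j) 0 (singularCohomology.one ℂ _) = 0 at h
    rw [singularCohomology.map_one] at h
    exact (smul_ne_zero hc0 h1) h
  · -- the identity
    rw [corrAction_apply, corrAction_apply, hK (corrAction_degree (d + 1) (show k + 2 * e = b + 2 * d by omega)), cupProduct_map]
    -- `(j ▷ X_t)^* pr_2^* = pr_2^*`
    have e1 : complexBetti.map (j ▷ fiberOver f t) k (complexBetti.map (snd 𝒳 (fiberOver f t)) k x) =
        complexBetti.map (snd (fiberOver f s) (fiberOver f t)) k x := by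
      rw [← CategoryTheory.comp_apply, ← complexBetti.map_comp, whiskerRight_snd]
    rw [e1]

include hf in
/-- **The restriction of an algebraic class of `𝒳 × X_t` to the member `X_s × X_t` is algebraic** (pull-back along a morphism of smooth
projective varieties preserves `Nᵉ`: Fulton Cor. 19.2 (b), the tree's PROVED `fulton1998_map_mem_algebraicClasses_holds`).
[cite: Fulton1998, §19.2 Cor. 19.2 (b)] [cite: VoisinHodgeII2003, Prop. 9.21 (i)] -/
theorem map_whiskerRight_fiberι_mem_algebraicClasses (s t : ComplexPoints S) {e : ℕ} {μ : complexBetti (𝒳 ⊗ fiberOver f t) (2 * e)}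
    (hμ : μ ∈ algebraicClasses (𝒳 ⊗ fiberOver f t) e) :
    complexBetti.map (fiberι f s ▷ fiberOver f t) (2 * e) μ ∈ algebraicClasses (fiberOver f s ⊗ fiberOver f t) e :=
  fulton1998_map_mem_algebraicClasses_holds (fiberι f s ▷ fiberOver f t)
    (IsSmoothProjective.tensor_holds hf.isSmoothProjective_total (hf.isSmoothProjective_fiberOver t))
    (IsSmoothProjective.tensor_holds (hf.isSmoothProjective_fiberOver s) (hf.isSmoothProjective_fiberOver t)) e μ hμ

end Restriction

/-! ## §2 The half inverse is the lift problem for the product family `𝒳 × X_t → S` at the class `P_t` -/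

section Lift

/-- **HALF INVERSE ⟺ AN ALGEBRAIC CLASS OF `𝒳 × X_t` RESTRICTS ON THE MEMBER `X_t × X_t` TO THE INVARIANT PROJECTOR.** On a compact pencil of
abelian `d`-folds, `t ∈ S(ℂ)`, `k ≤ 2d`: there is an algebraic correspondence `M : Hᵏ(X_t) → Hᵏ(𝒳)` with `j_t^* M j_t^* = j_t^*` and
`j_t^* M (ker j_{t*}) = 0` (a half inverse, part XLVI-b) IF AND ONLY IF there is an algebraic class `μ ∈ N^d H^{2d}((𝒳 × X_t)(ℂ))` whose RESTRICTION
`(j_t ▷ X_t)^* μ` to the member `X_t × X_t` over `t` of the product family acts on `Hᵏ(X_t)` as the invariant projector `P_t` (identity on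
`j_t^* Hᵏ(𝒳)`, zero on `ker j_{t*}`). ⟹: `M = [μ₀]_*` for the complex orientations (part XXII-e), `μ := K μ₀` (§1); ⟸: `M := K⁻¹ [μ]_*`.
**The half inverse is the lift problem (L) of the axis for the family `𝒳 × X_t → S` over the CURVE `S`, at the class `P_t` of ONE member.**
[cite: Fulton1998, Thm. 6.2 (a) and §16.1] [cite: Andre1996Motifs, §5.1 (p. 25) and §6.3] [cite: Kleiman1968AlgebraicCycles, Appendix to §2, Thm. 2A11] -/
theorem halfInverse_iff_exists_restrict_acts_as_invariantProjector (t : ComplexPoints S) {k : ℕ} (hk : k ≤ 2 * d) :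
    (∃ M : complexBetti (fiberOver f t) k →ₗ[ℂ] complexBetti 𝒳 k, IsAlgebraicCorrespondence (d + 1) d 𝒳 (fiberOver f t) M ∧
        (∀ W, 𝐣[t, k] (M (𝐣[t, k] W)) = 𝐣[t, k] W) ∧ ∀ x, 𝐆[hf, t, k] x = 0 → 𝐣[t, k] (M x) = 0) ↔
      ∃ μ ∈ algebraicClasses (𝒳 ⊗ fiberOver f t) d,
        (∀ W : complexBetti 𝒳 k, 𝐑₂[hf, t, t, (rfl : k + 2 * d = k + 2 * d)]
            (complexBetti.map (fiberι f t ▷ fiberOver f t) (2 * d) μ) (𝐣[t, k] W) = 𝐣[t, k] W) ∧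
        ∀ x, 𝐆[hf, t, k] x = 0 →
          𝐑₂[hf, t, t, (rfl : k + 2 * d = k + 2 * d)] (complexBetti.map (fiberι f t ▷ fiberOver f t) (2 * d) μ) x = 0 := by
  have hX := hf.isSmoothProjective_total
  have hXt := hf.isSmoothProjective_fiberOver t
  obtain ⟨K, hK0, hK⟩ := exists_map_fiberι_corrAction_eq_smul_restrict hf t t
  constructor
  · rintro ⟨M, algM, hM, hM0⟩
    obtain ⟨e, hab, μ, hμ, rfl⟩ := IsAlgebraicCorrespondence.exists_eq_corrAction hX hXt algM
    obtain rfl : d = e := by omega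
    refine ⟨K • μ, Submodule.smul_mem _ _ hμ, fun W ↦ ?_, fun x hx ↦ ?_⟩
    · have h := hK (rfl : k + 2 * d = k + 2 * d) μ (𝐣[t, k] W)
      rw [hM W] at h
      rw [map_smul, map_smul, LinearMap.smul_apply]
      exact h.symm
    · have h := hK (rfl : k + 2 * d = k + 2 * d) μ x
      rw [hM0 x hx] at h
      rw [map_smul, map_smul, LinearMap.smul_apply]
      exact h.symm
  · rintro ⟨μ, hμ, hid, h0⟩
    refine ⟨K⁻¹ • 𝐌[hf, t, (rfl : k + 2 * d = k + 2 * d)] μ,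
      IsAlgebraicCorrespondence.smul hX hXt (isAlgebraicCorrespondence_corrAction_complex hX hXt _ (by omega) hμ) K⁻¹,
      fun W ↦ ?_, fun x hx ↦ ?_⟩
    · rw [LinearMap.smul_apply, map_smul, hK (rfl : k + 2 * d = k + 2 * d) μ (𝐣[t, k] W), smul_smul, inv_mul_cancel₀ hK0, one_smul, hid W]
    · rw [LinearMap.smul_apply, map_smul, hK (rfl : k + 2 * d = k + 2 * d) μ x, smul_smul, inv_mul_cancel₀ hK0, one_smul, h0 x hx]

/-- **A TOPOLOGICAL HALF INVERSE ALWAYS EXISTS** (linear algebra on `Hᵏ(X_t) = j_t^* Hᵏ(𝒳) ⊕ ker j_{t*}`, part XXVI-a / XL-a): a linear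
`M₀ : Hᵏ(X_t) → Hᵏ(𝒳)` with `j_t^* M₀ j_t^* = j_t^*` and `j_t^* M₀ (ker j_{t*}) = 0` — a linear section of `j_t^*` onto its image composed with the
invariant projector. β asks for an ALGEBRAIC one. [cite: DeligneHodgeII1971, Thm. 4.1.1 and Cor. 4.2.8] [folklore] -/
theorem exists_topological_halfInverse (t : ComplexPoints S) (k : ℕ) :
    ∃ M₀ : complexBetti (fiberOver f t) k →ₗ[ℂ] complexBetti 𝒳 k,
      (∀ W, 𝐣[t, k] (M₀ (𝐣[t, k] W)) = 𝐣[t, k] W) ∧ ∀ x, 𝐆[hf, t, k] x = 0 → 𝐣[t, k] (M₀ x) = 0 := by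
  have hc := isCompl_range_ker_fiberGysin hf t k
  -- a linear section of `j_t^*` over its range
  obtain ⟨σ, hσ⟩ := (𝐣[t, k].rangeRestrict).exists_rightInverse_of_surjective (LinearMap.range_rangeRestrict _)
  set P := Submodule.projectionOnto _ _ hc with hP
  refine ⟨σ ∘ₗ P, fun W ↦ ?_, fun x hx ↦ ?_⟩
  · have hW : 𝐣[t, k] W ∈ LinearMap.range 𝐣[t, k] := LinearMap.mem_range_self _ W
    have h1 : P (𝐣[t, k] W) = ⟨𝐣[t, k] W, hW⟩ := Submodule.projectionOnto_apply_left hc ⟨𝐣[t, k] W, hW⟩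
    have h2 : (𝐣[t, k].rangeRestrict (σ ⟨𝐣[t, k] W, hW⟩)) = ⟨𝐣[t, k] W, hW⟩ := by
      rw [← LinearMap.comp_apply, hσ, LinearMap.id_apply]
    have h3 := congrArg Subtype.val h2
    rw [LinearMap.codRestrict_apply] at h3
    rw [LinearMap.comp_apply, h1]
    exact h3
  · have h1 : P x = 0 := Submodule.projectionOnto_apply_right hc ⟨x, LinearMap.mem_ker.2 hx⟩
    rw [LinearMap.comp_apply, h1, map_zero, map_zero]

/-- **… AND IT IS THE CORRESPONDENCE OF A CLASS `W₀` ON `𝒳 × X_t`** (`k ≤ 2d`): there is `W₀ ∈ H^{2d}((𝒳 × X_t)(ℂ); ℂ)` whose correspondence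
`[W₀]_* : Hᵏ(X_t) → Hᵏ(𝒳)` satisfies `j_t^* [W₀]_* j_t^* = j_t^*` and `j_t^* [W₀]_* (ker j_{t*}) = 0` (§1: every linear map is a correspondence up to
a non-zero scalar). [cite: VoisinHodgeI2002, §11.3.3 Lemma 11.41 (11.11)] [cite: DeligneHodgeII1971, Cor. 4.2.8] -/
theorem exists_topological_halfInverse_class (t : ComplexPoints S) {k : ℕ} (hk : k ≤ 2 * d) :
    ∃ W₀ : complexBetti (𝒳 ⊗ fiberOver f t) (2 * d),
      (∀ W, 𝐣[t, k] (𝐌[hf, t, (rfl : k + 2 * d = k + 2 * d)] W₀ (𝐣[t, k] W)) = 𝐣[t, k] W) ∧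
      ∀ x, 𝐆[hf, t, k] x = 0 → 𝐣[t, k] (𝐌[hf, t, (rfl : k + 2 * d = k + 2 * d)] W₀ x) = 0 := by
  obtain ⟨M₀, hM₀, hM₀0⟩ := exists_topological_halfInverse hf t k
  obtain ⟨γ, c, hc0, hγ⟩ := exists_corrAction_eq_smul complexOrientationFamily hf.isSmoothProjective_total
    (hf.isSmoothProjective_fiberOver t) (rfl : k + 2 * d = k + 2 * d) (show k + (2 * d - k) = 2 * d by omega) M₀
  refine ⟨c⁻¹ • γ, fun W ↦ ?_, fun x hx ↦ ?_⟩
  · rw [map_smul, LinearMap.smul_apply, hγ, LinearMap.smul_apply, smul_smul, inv_mul_cancel₀ hc0, one_smul, hM₀ W]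
  · rw [map_smul, LinearMap.smul_apply, hγ, LinearMap.smul_apply, smul_smul, inv_mul_cancel₀ hc0, one_smul, hM₀0 x hx]

end Lift

/-! ## §3 A half inverse transports the invariants of `X_t` to EVERY member algebraically -/

section Transport

/-- **A HALF INVERSE AT `t` IS A TRANSPORT TO EVERY MEMBER**: if `j_t^* M j_t^* = j_t^*` and `j_t^* M (ker j_{t*}) = 0`, then for EVERY `s ∈ S(ℂ)`
`j_s^* M j_t^* = j_s^*` and `j_s^* M (ker j_{t*}) = 0` — because `ker j_t^* = ker j_s^*` on `H^•(𝒳)` (part XVII `ker_map_fiberι_eq`: the invariants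
of all members are the same quotient of `H^•(𝒳)`). Valid for ANY linear `M`. [cite: DeligneHodgeII1971, Thm. 4.1.1] [cite: Andre1996Motifs, §5.1 (p. 25)] -/
theorem map_fiberι_halfInverse_eq (t s : ComplexPoints S) {k : ℕ} (M : complexBetti (fiberOver f t) k →ₗ[ℂ] complexBetti 𝒳 k)
    (hM : ∀ W, 𝐣[t, k] (M (𝐣[t, k] W)) = 𝐣[t, k] W) (hM0 : ∀ x, 𝐆[hf, t, k] x = 0 → 𝐣[t, k] (M x) = 0) :
    (∀ W, 𝐣[s, k] (M (𝐣[t, k] W)) = 𝐣[s, k] W) ∧ ∀ x, 𝐆[hf, t, k] x = 0 → 𝐣[s, k] (M x) = 0 := by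
  have hker := ker_map_fiberι_eq hf k s t
  refine ⟨fun W ↦ ?_, fun x hx ↦ ?_⟩
  · have h : M (𝐣[t, k] W) - W ∈ LinearMap.ker 𝐣[t, k] := by
      rw [LinearMap.mem_ker, map_sub, hM W, sub_self]
    rw [← hker, LinearMap.mem_ker, map_sub, sub_eq_zero] at h
    exact h
  · have h : M x ∈ LinearMap.ker 𝐣[t, k] := LinearMap.mem_ker.2 (hM0 x hx)
    rw [← hker] at h
    exact LinearMap.mem_ker.1 h

/-- **β / A HALF INVERSE AT ONE POINT ⟹ ALGEBRAIC TRANSPORT CLASSES ON `X_s × X_t` FOR EVERY MEMBER `X_s`** (part XLV-c's conclusion, from the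
half inverse). On a compact pencil of abelian `d`-folds with a half inverse at `t` in degree `k`: for EVERY `s ∈ S(ℂ)` there is an ALGEBRAIC
class `c ∈ N^d H^{2d}((X_s × X_t)(ℂ))` on the abelian `2d`-fold `X_s × X_t` — namely `K • (j_s ▷ X_t)^* μ`, the restriction of the half-inverse
cycle to the member — whose correspondence `Hᵏ(X_t) → Hᵏ(X_s)` carries `j_t^* W ↦ j_s^* W` for every `W ∈ Hᵏ(𝒳)` and kills `ker j_{t*}`.
[cite: Fulton1998, Thm. 6.2 (a), §16.1 and Cor. 19.2 (b)] [cite: DeligneHodgeII1971, Thm. 4.1.1] [cite: Andre1996Motifs, §5.1 (p. 25)] -/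
theorem exists_algebraic_transport_of_halfInverse (t : ComplexPoints S) {k : ℕ}
    (hM : ∃ M : complexBetti (fiberOver f t) k →ₗ[ℂ] complexBetti 𝒳 k, IsAlgebraicCorrespondence (d + 1) d 𝒳 (fiberOver f t) M ∧
      (∀ W, 𝐣[t, k] (M (𝐣[t, k] W)) = 𝐣[t, k] W) ∧ ∀ x, 𝐆[hf, t, k] x = 0 → 𝐣[t, k] (M x) = 0)
    (s : ComplexPoints S) :
    ∃ c ∈ algebraicClasses (fiberOver f s ⊗ fiberOver f t) d,
      (∀ W : complexBetti 𝒳 k, 𝐑₂[hf, s, t, (rfl : k + 2 * d = k + 2 * d)] c (𝐣[t, k] W) = 𝐣[s, k] W) ∧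
      ∀ x, 𝐆[hf, t, k] x = 0 → 𝐑₂[hf, s, t, (rfl : k + 2 * d = k + 2 * d)] c x = 0 := by
  have hX := hf.isSmoothProjective_total
  have hXt := hf.isSmoothProjective_fiberOver t
  obtain ⟨M, algM, hM, hM0⟩ := hM
  obtain ⟨hMs, hM0s⟩ := map_fiberι_halfInverse_eq hf t s M hM hM0
  obtain ⟨e, hab, μ, hμ, rfl⟩ := IsAlgebraicCorrespondence.exists_eq_corrAction hX hXt algM
  obtain rfl : d = e := by omega
  obtain ⟨K, -, hK⟩ := exists_map_fiberι_corrAction_eq_smul_restrict hf s t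
  refine ⟨K • complexBetti.map (fiberι f s ▷ fiberOver f t) (2 * d) μ,
    Submodule.smul_mem _ _ (map_whiskerRight_fiberι_mem_algebraicClasses hf s t hμ), fun W ↦ ?_, fun x hx ↦ ?_⟩
  · rw [map_smul, LinearMap.smul_apply, ← hK (rfl : k + 2 * d = k + 2 * d) μ (𝐣[t, k] W), hMs W]
  · rw [map_smul, LinearMap.smul_apply, ← hK (rfl : k + 2 * d = k + 2 * d) μ x, hM0s x hx]

/-- **The transport correspondence is unique** (as a map `Hᵏ(X_t) → Hᵏ(X_s)`): two maps carrying `j_t^* W ↦ j_s^* W` and killing `ker j_{t*}` agree,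
since `Hᵏ(X_t) = j_t^* Hᵏ(𝒳) ⊕ ker j_{t*}` (part XXVI-a / XL-a). [cite: DeligneHodgeII1971, Cor. 4.2.8] [folklore] -/
theorem transport_unique' (t s : ComplexPoints S) {k : ℕ} (R R' : complexBetti (fiberOver f t) k →ₗ[ℂ] complexBetti (fiberOver f s) k)
    (hR : ∀ W, R (𝐣[t, k] W) = 𝐣[s, k] W) (hR0 : ∀ x, 𝐆[hf, t, k] x = 0 → R x = 0)
    (hR' : ∀ W, R' (𝐣[t, k] W) = 𝐣[s, k] W) (hR'0 : ∀ x, 𝐆[hf, t, k] x = 0 → R' x = 0) : R = R' := by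
  have hc := isCompl_range_ker_fiberGysin hf t k
  refine LinearMap.ext fun x ↦ ?_
  obtain ⟨y, z, hy, hz, rfl⟩ := (Submodule.codisjoint_iff_exists_add_eq.1 hc.codisjoint) x
  obtain ⟨W, rfl⟩ := hy
  rw [map_add, map_add, hR W, hR' W, hR0 z (LinearMap.mem_ker.1 hz), hR'0 z (LinearMap.mem_ker.1 hz)]

end Transport

end Summit.HodgeConjecture.HodgeConjecture.Ring2.AbelianAll

end
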